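import Mathlib
import Summits.MatrixMultiplication.MatrixMultiplication.Theorems.SnSubsetDichotomyPolynomialSlackDepletedFlatAtom

/-!
# The hub atom of small area: a hub lemma from an area bound

Crux `Summit.MatrixMultiplication.MatrixMultiplication.Theses.SnSubsetDichotomy.PolynomialSlack`
(item `stmt-MatrixMultiplication-8306`), level-one programme, line transport-split-hull, lead c9
(programme B, stub W1', the companion of the depleted flat atom `volume_le_of_depleted_flat_atom`).
For a TPP triple `S, T, U ⊆ S_n` of non-empty sets with quotient profiles `d_A, d_B, d_C`, a hub
position `k` of `U` and a FLAT ATOM `I × J` (`β ≤ d_B(j,k) ≤ 2β` on `J`, `γ ≤ d_C(k,i) ≤ 2γ` on `I`,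
`β, γ ≥ 16/n`), write `p_B = d_B(·,k) - 1/n`, `p_C = d_C(k,·) - 1/n`, `σ = Σ_J p_B`, `ρ = Σ_I p_C`,
`μ(v) = #{u ∈ U : u k = v}/|U|`, `X(v) = #{t ∈ T : t⁻¹v ∈ J}/|T|`, `Y(v) = #{s ∈ S : s⁻¹v ∈ I}/|S|`.
If the atom carries hub mass `Σ_v μXY ≥ h > 0`, has AREA `|I||J| ≤ A`, and its forced hits are at
most `(1+M)×` neutral, `Σ_{I×J} d_A p_B p_C ≤ (1+M)σρ/n` (`M ≥ 0`), then
`|S||T||U| ≤ 20(1+M)A²B/(h²n)` for every bound `B` on the volumes of TPP triples of `S_{n-1}`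
(`volume_le_of_hub_atom_of_area`). Proof: (1) FLATNESS — on the atom `p_B ≥ (15/16)β`,
`p_C ≥ (15/16)γ`, `σ ≤ 2β|J|`, `ρ ≤ 2γ|I|`; (2) FORCED HITS are `μ`-free,
`Σ_v XY = Σ_{I×J} d_A ≤ ((1+M)σρ/n)/((15/16)²βγ) =: Z` (`sum_pairMarginal_block_eq`); (3) a GOOD
VALUE `v` with `μXY(v) ≥ h²/(4Z)` (`exists_good_value_of_sum`); (4) FIBRING (`hub_fibring`):
`|S||T||U|·μXY(v) ≤ |I||J|·B`; with `σρ ≤ 4βγ|I||J|` and `|I||J| ≤ A` the constant is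
`16·(16/15)² < 20`.
-/
namespace Summit.MatrixMultiplication.MatrixMultiplication.Theorems.PolynomialSlack

set_option linter.dupNamespace false

open scoped BigOperators
open Literature.Combinatorics.Additive (TripleProductProperty)

/-- Final arithmetic: flatness `σ ≤ 2βx`, `ρ ≤ 2γy`, `W = σρ`, the area `xy ≤ A` and the fibred good
value `N·(h/2)²/Z ≤ yxB` with `Z = ((1+M)W/n)/((15/16)²βγ)` give `N ≤ 20(1+M)A²B/(h²n)`
(`16·(16/15)² < 20`). [folklore] -/
private theorem haa_final_arith {N W σ ρ x y β γ M h A Bc nR : ℝ} (hn : 0 < nR)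
    (hβ : 0 < β) (hγ : 0 < γ) (hM : 0 ≤ M) (hh : 0 < h) (hB : 0 ≤ Bc)
    (hx : 0 ≤ x) (hy : 0 ≤ y) (hW0 : 0 < W) (hρ0 : 0 ≤ ρ) (hσ : σ ≤ 2 * β * x)
    (hρ : ρ ≤ 2 * γ * y) (hW : W = σ * ρ) (hA : y * x ≤ A)
    (hfib : N * ((h / 2) ^ 2 / ((1 + M) * W / nR / ((15 / 16) ^ 2 * (β * γ)))) ≤ y * x * Bc) :
    N ≤ 20 * (1 + M) * A ^ 2 * Bc / (h ^ 2 * nR) := by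
  set P : ℝ := β * γ with hP
  have hP0 : 0 < P := mul_pos hβ hγ
  have hc0 : (0 : ℝ) < (15 / 16) ^ 2 * P := by positivity
  have hM1 : 0 < 1 + M := by linarith
  -- flatness: `W ≤ 4 P x y`
  have hWle : W ≤ 4 * P * (x * y) := by
    rw [hW, hP]
    calc σ * ρ ≤ (2 * β * x) * (2 * γ * y) := mul_le_mul hσ hρ hρ0 (by positivity)
      _ = 4 * (β * γ) * (x * y) := by ring
  -- the fibred good value, denominators cleared
  have hZ0 : 0 < (1 + M) * W / nR / ((15 / 16) ^ 2 * P) := by positivity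
  have h1 : N * (h / 2) ^ 2 ≤ y * x * Bc * ((1 + M) * W / nR / ((15 / 16) ^ 2 * P)) := by
    rw [mul_div_assoc'] at hfib
    exact (div_le_iff₀ hZ0).1 hfib
  have key : (1 + M) * W / nR / ((15 / 16) ^ 2 * P) * (nR * ((15 / 16) ^ 2 * P)) = (1 + M) * W := by
    rw [div_div, div_mul_cancel₀ _ (by positivity)]
  have h2 : N * (h / 2) ^ 2 * (nR * ((15 / 16) ^ 2 * P)) ≤ y * x * Bc * ((1 + M) * W) :=
    calc N * (h / 2) ^ 2 * (nR * ((15 / 16) ^ 2 * P))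
        ≤ y * x * Bc * ((1 + M) * W / nR / ((15 / 16) ^ 2 * P)) * (nR * ((15 / 16) ^ 2 * P)) :=
          mul_le_mul_of_nonneg_right h1 (by positivity)
      _ = y * x * Bc * ((1 + M) * W / nR / ((15 / 16) ^ 2 * P) * (nR * ((15 / 16) ^ 2 * P))) := by
          ring
      _ = y * x * Bc * ((1 + M) * W) := by rw [key]
  -- flatness in: `N (h/2)² n (15/16)² P ≤ y x B (1+M) 4 P x y`
  have h3 : N * (h / 2) ^ 2 * (nR * ((15 / 16) ^ 2 * P)) ≤
      y * x * Bc * ((1 + M) * (4 * P * (x * y))) :=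
    h2.trans (mul_le_mul_of_nonneg_left (mul_le_mul_of_nonneg_left hWle hM1.le) (by positivity))
  -- cancel `P`
  have h4 : N * h ^ 2 * nR * (15 / 16) ^ 2 ≤ 16 * (1 + M) * (x * y) ^ 2 * Bc := by
    have e1 : N * (h / 2) ^ 2 * (nR * ((15 / 16) ^ 2 * P)) =
        (N * h ^ 2 * nR * (15 / 16) ^ 2 / 4) * P := by ring
    have e2 : y * x * Bc * ((1 + M) * (4 * P * (x * y))) =
        (4 * (1 + M) * (x * y) ^ 2 * Bc) * P := by ring
    rw [e1, e2] at h3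
    have h5 := le_of_mul_le_mul_right h3 hP0
    linarith
  -- the area
  have hxy0 : 0 ≤ x * y := mul_nonneg hx hy
  have hA' : x * y ≤ A := by rw [mul_comm]; exact hA
  have h5 : (x * y) ^ 2 ≤ A ^ 2 := pow_le_pow_left₀ hxy0 hA' 2
  have h6 : N * h ^ 2 * nR * (15 / 16) ^ 2 ≤ 16 * (1 + M) * A ^ 2 * Bc := by
    have h7 := mul_le_mul_of_nonneg_left h5 (by positivity : (0 : ℝ) ≤ 16 * (1 + M) * Bc)
    linarith
  -- the constant
  have hQ : 0 ≤ (1 + M) * A ^ 2 * Bc := by positivity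
  rw [le_div_iff₀ (by positivity)]
  linarith

set_option maxHeartbeats 1600000 in
/-- **The hub atom of small area.** For `n ≥ 2`, a bound `B` on the volumes of TPP triples of
`S_{n-1}`, a TPP triple `S, T, U ⊆ S_n` of non-empty sets with quotient profiles `dA, dB, dC`, a hub
position `k`,
a flat atom `I × J` (`β ≤ dB j k ≤ 2β` on `J`, `γ ≤ dC k i ≤ 2γ` on `I`, `β, γ ≥ 16/n`), `M ≥ 0`,
hub mass `Σ_v μ(v)·X(v)·Y(v) ≥ h > 0`, area `|I|·|J| ≤ A` and forced hits at most `(1+M)×` neutral,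
`Σ_{I×J} dA·(dB - 1/n)·(dC - 1/n) ≤ (1+M)·(Σ_J (dB - 1/n))·(Σ_I (dC - 1/n))/n`:
`|S||T||U| ≤ 20·(1+M)·A²·B/(h²n)`. μ-free forced hits from `sum_pairMarginal_block_eq`, a good value
from `exists_good_value_of_sum`, and `hub_fibring`. [folklore] -/
theorem volume_le_of_hub_atom_of_area {n : ℕ} (hn : 2 ≤ n) (B : ℕ)
    (hB : ∀ S' T' U' : Finset (Equiv.Perm (Fin (n - 1))), TripleProductProperty S' T' U' →
      S'.card * T'.card * U'.card ≤ B)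
    {S T U : Finset (Equiv.Perm (Fin n))} (hTPP : TripleProductProperty S T U)
    (hS0 : S.Nonempty) (hT0 : T.Nonempty) (hU0 : U.Nonempty)
    (dA dB dC : Fin n → Fin n → ℝ)
    (hdA : ∀ i j, dA i j = (((S ×ˢ T).filter fun st => st.2 j = st.1 i).card : ℝ) / (S.card * T.card : ℕ))
    (hdB : ∀ j k, dB j k = (((T ×ˢ U).filter fun tu => tu.2 k = tu.1 j).card : ℝ) / (T.card * U.card : ℕ))
    (hdC : ∀ k i, dC k i = (((U ×ˢ S).filter fun us => us.2 i = us.1 k).card : ℝ) / (U.card * S.card : ℕ))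
    (k : Fin n) (J I : Finset (Fin n)) (β γ M h A : ℝ) (hβ : 16 / (n : ℝ) ≤ β)
    (hγ : 16 / (n : ℝ) ≤ γ) (hM : 0 ≤ M) (hh : 0 < h)
    (hJ : ∀ j ∈ J, β ≤ dB j k ∧ dB j k ≤ 2 * β) (hI : ∀ i ∈ I, γ ≤ dC k i ∧ dC k i ≤ 2 * γ)
    (hhub : h ≤ ∑ v : Fin n, ((U.filter fun u => u k = v).card : ℝ) / U.card *
      ((((T.filter fun t => t⁻¹ v ∈ J).card : ℝ) / T.card) *
        (((S.filter fun s => s⁻¹ v ∈ I).card : ℝ) / S.card)))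
    (harea : (I.card : ℝ) * J.card ≤ A)
    (hhits : ∑ i ∈ I, ∑ j ∈ J, dA i j * (dB j k - 1 / n) * (dC k i - 1 / n) ≤
      (1 + M) * ((∑ j ∈ J, (dB j k - 1 / n)) * (∑ i ∈ I, (dC k i - 1 / n))) / n) :
    ((S.card * T.card * U.card : ℕ) : ℝ) ≤ 20 * (1 + M) * A ^ 2 * B / (h ^ 2 * n) := by
  classical
  -- the profiles `dB`, `dC` enter only through the flatness hypotheses `hJ`, `hI`
  have _ := hdB
  have _ := hdC
  /- 0. the atom is non-empty (else the hub mass vanishes) -/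
  have hJne : J.Nonempty := by
    rw [Finset.nonempty_iff_ne_empty]; rintro rfl
    exact absurd (hhub.trans_eq (Finset.sum_eq_zero fun v _ => by simp)) (not_le.2 hh)
  have hIne : I.Nonempty := by
    rw [Finset.nonempty_iff_ne_empty]; rintro rfl
    exact absurd (hhub.trans_eq (Finset.sum_eq_zero fun v _ => by simp)) (not_le.2 hh)
  /- 1. scalars -/
  have hnR : (2 : ℝ) ≤ n := by exact_mod_cast hn
  have hn0 : (0 : ℝ) < n := by linarith
  have hβ0 : 0 < β := lt_of_lt_of_le (by positivity) hβ
  have hγ0 : 0 < γ := lt_of_lt_of_le (by positivity) hγ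
  have hinvB : 1 / (n : ℝ) ≤ β / 16 := by
    rw [div_le_div_iff₀ hn0 (by norm_num)]; rw [div_le_iff₀ hn0] at hβ; linarith
  have hinvC : 1 / (n : ℝ) ≤ γ / 16 := by
    rw [div_le_div_iff₀ hn0 (by norm_num)]; rw [div_le_iff₀ hn0] at hγ; linarith
  have h1n : (0 : ℝ) ≤ 1 / n := by positivity
  set cS : ℝ := (S.card : ℝ) with hcS
  set cT : ℝ := (T.card : ℝ) with hcT
  set cU : ℝ := (U.card : ℝ) with hcU
  have hcS0 : 0 < cS := by rw [hcS]; exact_mod_cast hS0.card_pos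
  have hcT0 : 0 < cT := by rw [hcT]; exact_mod_cast hT0.card_pos
  have hcU0 : 0 < cU := by rw [hcU]; exact_mod_cast hU0.card_pos
  have hαe : ((S.card * T.card : ℕ) : ℝ) = cS * cT := by push_cast; rw [hcS, hcT]
  have hNe : ((S.card * T.card * U.card : ℕ) : ℝ) = cS * cT * cU := by
    push_cast; rw [hcS, hcT, hcU]
  have hUcol : ∑ v : Fin n, ((U.filter fun u => u k = v).card : ℝ) = cU := by
    rw [hcU]; exact sum_marginal_col U k
  have hcUne : cU ≠ 0 := hcU0.ne'
  -- the hub-mass hypothesis, left-associated and over `cS, cT, cU`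
  have hhub' : 2 * (h / 2) ≤ ∑ v : Fin n, ((U.filter fun u => u k = v).card : ℝ) / cU *
      (((T.filter fun t => t⁻¹ v ∈ J).card : ℝ) / cT) *
        (((S.filter fun s => s⁻¹ v ∈ I).card : ℝ) / cS) := by
    calc 2 * (h / 2) = h := by ring
      _ ≤ _ := hhub
      _ = _ := Finset.sum_congr rfl fun v _ => by rw [hcS, hcT, hcU]; ring
  clear_value cS cT cU
  /- 2. flatness of the atom and the masses `σ`, `ρ` -/
  have hdA0 : ∀ i j, 0 ≤ dA i j := fun i j => by rw [hdA]; positivity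
  have hJ' : ∀ j ∈ J, 15 / 16 * β ≤ dB j k - 1 / n ∧ dB j k - 1 / n ≤ 2 * β := fun j hj =>
    ⟨by linarith [(hJ j hj).1], by linarith [(hJ j hj).2]⟩
  have hI' : ∀ i ∈ I, 15 / 16 * γ ≤ dC k i - 1 / n ∧ dC k i - 1 / n ≤ 2 * γ := fun i hi =>
    ⟨by linarith [(hI i hi).1], by linarith [(hI i hi).2]⟩
  have hpB0 : ∀ j ∈ J, 0 ≤ dB j k - 1 / n := fun j hj => le_trans (by positivity) (hJ' j hj).1
  have hpC0 : ∀ i ∈ I, 0 ≤ dC k i - 1 / n := fun i hi => le_trans (by positivity) (hI' i hi).1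
  set σ : ℝ := ∑ j ∈ J, (dB j k - 1 / n) with hσ
  set ρ : ℝ := ∑ i ∈ I, (dC k i - 1 / n) with hρ
  have hσlo : 15 / 16 * β * J.card ≤ σ := by
    have h1 := Finset.card_nsmul_le_sum J _ _ fun j hj => (hJ' j hj).1
    rwa [nsmul_eq_mul, mul_comm] at h1
  have hρlo : 15 / 16 * γ * I.card ≤ ρ := by
    have h1 := Finset.card_nsmul_le_sum I _ _ fun i hi => (hI' i hi).1
    rwa [nsmul_eq_mul, mul_comm] at h1
  have hσhi : σ ≤ 2 * β * J.card := by
    have h1 := Finset.sum_le_card_nsmul J _ _ fun j hj => (hJ' j hj).2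
    rw [nsmul_eq_mul] at h1
    linarith
  have hρhi : ρ ≤ 2 * γ * I.card := by
    have h1 := Finset.sum_le_card_nsmul I _ _ fun i hi => (hI' i hi).2
    rw [nsmul_eq_mul] at h1
    linarith
  have hJc : (1 : ℝ) ≤ J.card := by exact_mod_cast hJne.card_pos
  have hIc : (1 : ℝ) ≤ I.card := by exact_mod_cast hIne.card_pos
  have hσ0 : 0 < σ := by nlinarith [mul_le_mul_of_nonneg_left hJc hβ0.le]
  have hρ0 : 0 < ρ := by nlinarith [mul_le_mul_of_nonneg_left hIc hγ0.le]
  set W : ℝ := σ * ρ with hW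
  have hW0 : 0 < W := mul_pos hσ0 hρ0
  have hM1 : 0 < 1 + M := by linarith
  /- 3. the three laws at the hub -/
  set mA : Fin n → Fin n → ℝ :=
    fun i j => (((S ×ˢ T).filter fun st => st.2 j = st.1 i).card : ℝ) with hmA
  have hdA' : ∀ i j, dA i j = mA i j / (cS * cT) := fun i j => by rw [hdA, hαe]
  clear_value mA
  set μ : Fin n → ℝ := fun v => ((U.filter fun u => u k = v).card : ℝ) / cU with hμ
  set X : Fin n → ℝ := fun v => ((T.filter fun t => t⁻¹ v ∈ J).card : ℝ) / cT with hX
  set Y : Fin n → ℝ := fun v => ((S.filter fun s => s⁻¹ v ∈ I).card : ℝ) / cS with hY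
  have hμ0 : ∀ v, 0 ≤ μ v := fun v => by rw [hμ]; exact div_nonneg (Nat.cast_nonneg _) hcU0.le
  have hX0 : ∀ v, 0 ≤ X v := fun v => by rw [hX]; exact div_nonneg (Nat.cast_nonneg _) hcT0.le
  have hY0 : ∀ v, 0 ≤ Y v := fun v => by rw [hY]; exact div_nonneg (Nat.cast_nonneg _) hcS0.le
  have hμ1 : ∑ v : Fin n, μ v = 1 := by
    rw [hμ]; dsimp only
    rw [← Finset.sum_div, hUcol, div_self hcUne]
  have hsum : 2 * (h / 2) ≤ ∑ v : Fin n, μ v * X v * Y v := by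
    have e : ∑ v : Fin n, μ v * X v * Y v =
        ∑ v : Fin n, ((U.filter fun u => u k = v).card : ℝ) / cU *
          (((T.filter fun t => t⁻¹ v ∈ J).card : ℝ) / cT) *
            (((S.filter fun s => s⁻¹ v ∈ I).card : ℝ) / cS) := by
      refine Finset.sum_congr rfl fun v _ => ?_
      rw [hμ, hX, hY]
    rw [e]; exact hhub'
  clear_value μ X Y
  have key2T : ∀ a b : ℝ, a / cT * (b / cS) = a * b / (cS * cT) := by
    intro a b; rw [div_mul_div_comm, mul_comm cT cS]
  /- 4. FORCED HITS: `Σ_v X Y = Σ_{I×J} dA ≤ ((1+M)W/n)/((15/16)²βγ)` -/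
  have hc2 : 0 < (15 / 16) ^ 2 * (β * γ) := by positivity
  set Z : ℝ := (1 + M) * W / n / ((15 / 16) ^ 2 * (β * γ)) with hZ
  have hZ0 : 0 < Z := by positivity
  have hforced : ∑ v : Fin n, X v * Y v ≤ Z := by
    have hblock := sum_pairMarginal_block_eq S T I J
    have hblockR : ∑ i ∈ I, ∑ j ∈ J, mA i j = ∑ v : Fin n,
        ((T.filter fun t => t⁻¹ v ∈ J).card : ℝ) * ((S.filter fun s => s⁻¹ v ∈ I).card : ℝ) := by
      simp only [hmA]; exact_mod_cast hblock
    have e1 : ∑ v : Fin n, X v * Y v = ∑ i ∈ I, ∑ j ∈ J, dA i j := by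
      have h' : ∑ v : Fin n, X v * Y v = (∑ i ∈ I, ∑ j ∈ J, mA i j) / (cS * cT) := by
        rw [hblockR, Finset.sum_div]
        refine Finset.sum_congr rfl fun v _ => ?_
        rw [hX, hY]; dsimp only
        rw [key2T]
      rw [h', Finset.sum_div]
      refine Finset.sum_congr rfl fun i _ => ?_
      rw [Finset.sum_div]
      exact Finset.sum_congr rfl fun j _ => (hdA' i j).symm
    have e2 : (15 / 16) ^ 2 * (β * γ) * ∑ i ∈ I, ∑ j ∈ J, dA i j ≤
        ∑ i ∈ I, ∑ j ∈ J, dA i j * (dB j k - 1 / n) * (dC k i - 1 / n) := by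
      rw [Finset.mul_sum]
      refine Finset.sum_le_sum fun i hi => ?_
      rw [Finset.mul_sum]
      refine Finset.sum_le_sum fun j hj => ?_
      have hb := (hJ' j hj).1
      have hc := (hI' i hi).1
      have hA := hdA0 i j
      calc (15 / 16) ^ 2 * (β * γ) * dA i j = dA i j * (15 / 16 * β) * (15 / 16 * γ) := by ring
        _ ≤ dA i j * (dB j k - 1 / n) * (15 / 16 * γ) :=
            mul_le_mul_of_nonneg_right (mul_le_mul_of_nonneg_left hb hA) (by positivity)
        _ ≤ dA i j * (dB j k - 1 / n) * (dC k i - 1 / n) :=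
            mul_le_mul_of_nonneg_left hc (mul_nonneg hA (hpB0 j hj))
    rw [e1, hZ, le_div_iff₀ hc2]
    calc (∑ i ∈ I, ∑ j ∈ J, dA i j) * ((15 / 16) ^ 2 * (β * γ))
        = (15 / 16) ^ 2 * (β * γ) * ∑ i ∈ I, ∑ j ∈ J, dA i j := mul_comm _ _
      _ ≤ _ := e2
      _ ≤ (1 + M) * W / n := hhits
  /- 5. a good common value -/
  obtain ⟨v, hv⟩ :=
    exists_good_value_of_sum μ X Y (h / 2) Z hμ0 hμ1.le hX0 hY0 (half_pos hh) hZ0 hsum hforced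
  /- 6. fibring at `(k, v)` -/
  have hfibR : ((S.filter fun s => s⁻¹ v ∈ I).card : ℝ) * ((T.filter fun t => t⁻¹ v ∈ J).card : ℝ) *
      ((U.filter fun u => u k = v).card : ℝ) ≤ (I.card : ℝ) * (J.card : ℝ) * B := by
    exact_mod_cast hub_fibring B hB hTPP I J k v
  have key3 : ∀ a b c : ℝ, cS * cT * cU * (a / cU * (b / cT) * (c / cS)) = c * b * a := by
    intro a b c; field_simp
  have hvol : cS * cT * cU * (μ v * X v * Y v) =
      ((S.filter fun s => s⁻¹ v ∈ I).card : ℝ) * ((T.filter fun t => t⁻¹ v ∈ J).card : ℝ) *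
        ((U.filter fun u => u k = v).card : ℝ) := by
    rw [hμ, hX, hY]; dsimp only
    rw [key3]
  have hN0 : 0 < cS * cT * cU := mul_pos (mul_pos hcS0 hcT0) hcU0
  have hmain : cS * cT * cU * ((h / 2) ^ 2 / Z) ≤ (I.card : ℝ) * (J.card : ℝ) * B :=
    calc cS * cT * cU * ((h / 2) ^ 2 / Z) ≤ cS * cT * cU * (μ v * X v * Y v) :=
          mul_le_mul_of_nonneg_left hv hN0.le
      _ = _ := hvol
      _ ≤ _ := hfibR
  /- 7. arithmetic -/
  rw [hNe]
  exact haa_final_arith hn0 hβ0 hγ0 hM hh (Nat.cast_nonneg B) (Nat.cast_nonneg J.card)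
    (Nat.cast_nonneg I.card) hW0 hρ0.le hσhi hρhi hW harea hmain

end Summit.MatrixMultiplication.MatrixMultiplication.Theorems.PolynomialSlack
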